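import Summits.AnomalousDissipation.AnomalousDissipation.Theorems.LimitingAbsorptionRelaxationBoundsInventorySums
import Literature.Analysis.FluidPDE.PassiveScalarForcedClass
import HarnessLib

/-!
# Route LimitingAbsorption — `RelaxationBoundsInventory`: the Riemann-sum source term converges

Stub `stub_riemannSource` of line `Sketch` for crux stmt-AnomalousDissipation-2940
(`RelaxationBoundsInventory`, route `route-AnomalousDissipation-LimitingAbsorption`).

The Riemann–Duhamel superposition `W_N` of releases of a profile `h ∈ L²(T^d)` at the grid phases
`kδ` (`δ = T/(N+1)`) solves the sourced weak identity with the time-discrete source term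
`∑_{k ≤ N} δ ∫ h ψ(kδ)` (`LapInventory.integral_superposition_mul_weakIntegrand`). Along step
counts `N_j → ∞` these source terms converge to the steady-source term `∫_{(0,T)} ∫ h ψ(t)` of
the sourced weak formulation:

* `continuousOn_integral_mul_test` — `t ↦ ∫ h ψ(t)` is continuous on `[0,T]` for `h ∈ L²(T^d)`
  and a space–time test function `ψ` (dominated convergence: `ψ` is jointly continuous, hence
  bounded on `[0,T] × T^d`, and `h ∈ L² ⊂ L¹` on the probability space `T^d`);
* `stub_riemannSource` — `∑_{k ≤ N_j} δ_j ∫ h ψ(kδ_j) → ∫_{(0,T)} ∫ h ψ`, `δ_j = T/(N_j+1)`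
  (`LapInventory.tendsto_riemann_sum` composed with `N_j → ∞`; the interval integral over
  `[0,T]` is the set integral over `(0,T)`).

## References

* A. Pazy, *Semigroups of Linear Operators and Applications to PDE* (Springer 1983), Ch. 5,
  §5.1–5.2 (Duhamel / variation of constants). [`Pazy1983`]
* R. J. DiPerna, P.-L. Lions, Invent. Math. 98 (1989), §II.1 (weak formulation with a source).
  [`DiPernaLions1989`]
-/

noncomputable section

open MeasureTheory Set Filter Function TopologicalSpace Topology
open scoped ENNReal NNReal InnerProductSpace BigOperators

namespace Summit.AnomalousDissipation.AnomalousDissipation.Theorems.RelaxationBoundsInventory.RiemannSource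

set_option linter.dupNamespace false

open Literature.Analysis Literature.Analysis.FluidPDE Literature.Analysis.FluidPDE.Torus

variable {d : Type*} [Fintype d]

/-- **The pairing `t ↦ ∫ h ψ(t)` is continuous on `[0,T]`** for `h ∈ L²(T^d)` and a space–time
test function `ψ`: `ψ` is jointly continuous, hence bounded by some `C` on `[0,T] × T^d`, and
`|h x ψ t x| ≤ C |h x|` with `h ∈ L¹(T^d)`; dominated convergence. [folklore] -/
theorem continuousOn_integral_mul_test {T : ℝ} {h : UnitAddTorus d → ℝ} (hh : MemLp h 2 volume)
    {ψ : ℝ → UnitAddTorus d → ℝ} (hψ : FunctionSpaces.Torus.IsSpaceTimeTest T ψ) :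
    ContinuousOn (fun t => ∫ x, h x * ψ t x) (Icc 0 T) := by
  have hψc : Continuous (uncurry ψ) :=
    FunctionSpaces.Torus.continuous_uncurry_of_continuous_stLift hψ.1.continuous
  obtain ⟨C, hC⟩ := exists_bound_of_continuous_uncurry hψc 0 T
  have hh1 : Integrable h volume := hh.integrable one_le_two
  refine continuousOn_of_dominated (bound := fun x => ‖h x‖ * C) ?_ ?_ (hh1.norm.mul_const C) ?_
  · intro t _
    exact hh1.aestronglyMeasurable.mul (hψc.comp (Continuous.prodMk_right t)).aestronglyMeasurable
  · intro t ht
    refine ae_of_all _ fun x => ?_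
    rw [norm_mul]
    exact mul_le_mul_of_nonneg_left (hC t ht x) (norm_nonneg _)
  · refine ae_of_all _ fun x => ?_
    exact (continuous_const.mul (hψc.comp (Continuous.prodMk_left x))).continuousOn

/-- **S2 `stub_riemannSource`.** For `h ∈ L²(T^d)`, a space–time test function `ψ` on `[0,T)`,
`T > 0`, and step counts `N_j → ∞`, the Riemann-sum source terms of the superpositions converge:
`∑_{k ≤ N_j} δ_j ∫ h ψ(kδ_j) → ∫_{(0,T)} ∫ h ψ(t)`, `δ_j = T/(N_j+1)` (`t ↦ ∫ h ψ(t)` is continuous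
on `[0,T]` by dominated convergence; `LapInventory.tendsto_riemann_sum`; the interval integral
over `[0,T]` is the set integral over `(0,T)`). [folklore] -/
theorem stub_riemannSource {T : ℝ} (hT : 0 < T) {h : UnitAddTorus d → ℝ} (hh : MemLp h 2 volume)
    {ψ : ℝ → UnitAddTorus d → ℝ} (hψ : FunctionSpaces.Torus.IsSpaceTimeTest T ψ)
    {Nf : ℕ → ℕ} (hN : Tendsto Nf atTop atTop) :
    Tendsto (fun j => ∑ k ∈ Finset.range (Nf j + 1),
        T / (Nf j + 1) * ∫ x, h x * ψ (k * (T / (Nf j + 1))) x) atTop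
      (𝓝 (∫ t in Ioo 0 T, ∫ x, h x * ψ t x)) := by
  have h1 := (LapInventory.tendsto_riemann_sum hT (continuousOn_integral_mul_test hh hψ)).comp hN
  rw [intervalIntegral.integral_of_le hT.le, integral_Ioc_eq_integral_Ioo] at h1
  exact h1

end Summit.AnomalousDissipation.AnomalousDissipation.Theorems.RelaxationBoundsInventory.RiemannSource

end
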